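import Summits.NavierStokesRegularity.OSWSelfSimilar.OSWMechanismGlobalBranch01
import HarnessLib

/-!
# OSW self-similar mechanism, companion module (MECHANISM.md §§29–34: THEOREMS M32–M39) — part 02 of 09

1-D model (gCLM/OSW), computer-assisted; not Euler/NS.  Filed under `Summits/NavierStokesRegularity/OSWSelfSimilar/` by a prover-role courier on behalf of the
mechanism seat pub-oswblow-mech (planner-pub-oswblow-mech-g29-0), cell pub-oswblow (host summit NavierStokesRegularity); the gate admits the path but
not role planner.  CONTENT = the staged transcript `pub-oswblow-mech/lean/OSWMechanismGlobalBranch.lean` (sha256 4e5de3f87ec94598…,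
2998 lines), source lines 380–741, UNCHANGED except: (i) namespace prefix `OSWSelfSimilar.Mechanism` → `Summit.NavierStokesRegularity.OSWSelfSimilar.Mechanism`;
(ii) the frames open at the cut (section (anonymous) › namespace Summit.NavierStokesRegularity.OSWSelfSimilar.Mechanism.GlobalBranch) are re-opened above the body with their `open` commands replayed, and closed
at the end; (iii) this docstring.  Generated by `pub-oswblow-mech/lean/courier/make_split.py`; the parts must be filed IN ORDER
(each imports its predecessor).  First/last declarations here: `bordered_index` … `weight_factor` (34 in this part).
AI-written transcript; kernel-checked on the farm as ONE file before splitting (see the kit's CHECKS); to be checked, not trusted.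
COURIER NOTE (prover-role courier seat pub-oswblow-courier g2, 2026-08-25): in addition to the changes listed above, 3 one-line docstrings were added at filing on the declarations the transcript left undocumented (tree docstring rule); each only restates the formal statement of its declaration; nothing else was touched. List of the added docstrings: HOME `pub-oswblow-courier/g2/DOCSTRINGS.tsv`.
-/

noncomputable section
open Complex Set Filter
open scoped Topology
open Literature.Analysis.FluidPDE.OkamotoSakajoWunsch2008
namespace Summit.NavierStokesRegularity.OSWSelfSimilar.Mechanism.GlobalBranch

/-- LEMMA 29.2 (c), the index bookkeeping only: bordering an index-`+1` operator by one bounded functional gives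
index `0`; by the functional and the parameter, index `+1`. -/
theorem bordered_index : ((1 : ℤ) - 1 = 0) ∧ ((1 : ℤ) - 1 + 1 = 1) := by norm_num

/-! ### The logical spine of THEOREM M32, Step 3 (no loop) and COROLLARY 29.7 (iii) (the ladder) -/

/-- Step 3, `N = 1`: a set `K ⊆ U` cannot contain a point outside `U`; applied to `K = cl(𝒜₀)` and `z₀ ∈ ∂U`,
`z₀ ∉ U`: if `z₀ ∈ cl(𝒜₀)` then `cl(𝒜₀) ⊄ U` — the compact-loop case of [BT03, Thm 9.1.1] does not occur. -/
theorem noLoop_of_start_outside {X : Type*} {K U : Set X} {z : X} (hKU : K ⊆ U) (hz : z ∉ U) : z ∉ K :=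
  fun h => hz (hKU h)

/-- If `z ∈ closure A` and `z ∉ U` then `closure A ⊄ U`. -/
theorem closure_not_subset_of_mem {X : Type*} [TopologicalSpace X] {A U : Set X} {z : X}
    (hz : z ∈ closure A) (hzU : z ∉ U) : ¬ (closure A ⊆ U) :=
  fun h => hzU (h hz)

/-- The starting point lies in the closure of the first arc: if `γ(σ) → z₀` as `σ ↓ 0` and `γ(σ) ∈ A` for small
`σ > 0`, then `z₀ ∈ cl A`. -/
theorem start_mem_closure {X : Type*} [TopologicalSpace X] {A : Set X} {γ : ℝ → X} {z₀ : X}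
    (hγ : Filter.Tendsto γ (nhdsWithin 0 (Set.Ioi 0)) (nhds z₀))
    (hA : ∀ᶠ σ in nhdsWithin 0 (Set.Ioi 0), γ σ ∈ A) : z₀ ∈ closure A :=
  mem_closure_of_tendsto hγ hA

/-- A point of the (open) set `U` is not on its frontier; with `z₀ ∈ frontier U`: `z₀ ∉ U`. -/
theorem not_mem_of_mem_frontier_of_isOpen {X : Type*} [TopologicalSpace X] {U : Set X} {z : X}
    (hU : IsOpen U) (hz : z ∈ frontier U) : z ∉ U := by
  rw [hU.frontier_eq] at hz
  exact hz.2

/-- **COROLLARY 29.7 (iii), the intermediate-value step (PROVED):** if `p` is continuous on `(0,∞)`, comes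
arbitrarily close to `1` from below `1 + η` near `0⁺`, and is unbounded above on `(0,∞)`, then every `P > 1` is a
value `p σ`, `σ > 0`. -/
theorem ladder_of_unbounded (p : ℝ → ℝ) (hc : ContinuousOn p (Set.Ioi 0))
    (h0 : ∀ η : ℝ, 0 < η → ∃ σ : ℝ, 0 < σ ∧ p σ < 1 + η)
    (hub : ∀ M : ℝ, ∃ σ : ℝ, 0 < σ ∧ M < p σ) :
    ∀ P : ℝ, 1 < P → ∃ σ : ℝ, 0 < σ ∧ p σ = P := by
  intro P hP
  obtain ⟨σ₁, hσ₁, h1⟩ := h0 (P - 1) (by linarith)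
  obtain ⟨σ₂, hσ₂, h2⟩ := hub P
  have h1' : p σ₁ < P := by linarith
  rcases le_total σ₁ σ₂ with h | h
  · have hcI : ContinuousOn p (Set.Icc σ₁ σ₂) :=
      hc.mono fun x hx => lt_of_lt_of_le hσ₁ hx.1
    have hmem : P ∈ Set.Icc (p σ₁) (p σ₂) := ⟨h1'.le, h2.le⟩
    obtain ⟨σ, hσ, hpσ⟩ := intermediate_value_Icc h hcI hmem
    exact ⟨σ, lt_of_lt_of_le hσ₁ hσ.1, hpσ⟩
  · have hcI : ContinuousOn p (Set.Icc σ₂ σ₁) :=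
      hc.mono fun x hx => lt_of_lt_of_le hσ₂ hx.1
    have hmem : P ∈ Set.Icc (p σ₁) (p σ₂) := ⟨h1'.le, h2.le⟩
    obtain ⟨σ, hσ, hpσ⟩ := intermediate_value_Icc' h hcI hmem
    exact ⟨σ, lt_of_lt_of_le hσ₂ hσ.1, hpσ⟩

/-- From a limit `p σ → 1` (`σ ↓ 0`) to the hypothesis `h0` of `ladder_of_unbounded`. -/
theorem near_one_of_tendsto (p : ℝ → ℝ) (hT : Filter.Tendsto p (nhdsWithin 0 (Set.Ioi 0)) (nhds 1)) :
    ∀ η : ℝ, 0 < η → ∃ σ : ℝ, 0 < σ ∧ p σ < 1 + η := by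
  intro η hη
  have h1 : ∀ᶠ σ in nhdsWithin 0 (Set.Ioi 0), p σ < 1 + η :=
    hT (Iio_mem_nhds (by linarith))
  have h2 : ∀ᶠ σ in nhdsWithin (0:ℝ) (Set.Ioi 0), σ ∈ Set.Ioi (0:ℝ) := self_mem_nhdsWithin
  obtain ⟨σ, hσ1, hσ2⟩ := (h1.and h2).exists
  exact ⟨σ, hσ2, hσ1⟩

/-! #### Typed statements of §29 (Props over the profile hypothesis `NegP`, intended `NegP := NegProfileHyp`; no axiom, no sorry), the BRANCH FAMILY (the typed
shadow of THEOREM M32's curve), and the kernel-checked REDUCTIONS `BranchFamily.ladder` / `BranchFamily.rung`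
(COROLLARY 29.7 (iii)), `BranchFamily.sink_lower_of_bounded` (COROLLARY 29.7 (iv)), `ladderOnBranch_of_v23`. -/

/-- **LEMMA 29.1 (b), typed (PROVED pen-and-paper; the trigonometric core is `kernel_lower_bound`):** for a negative
class-(H) profile, `g(x) ≥ (log 2/(2π))·m₁·sin x` on `[0,π]`, `m₁ = ∫₀^π F sin y`, `F = −f` — the velocity is
comparable to `sin x` from below by ONE moment of `F` ((29.2) inserted in (17.1)). -/
def KernelLowerStatement (NegP : ℝ → (ℤ → ℂ) → Prop) : Prop :=
  ∀ (a : ℝ) (c : ℤ → ℂ), NegP a c →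
    ∀ x : ℝ, 0 ≤ x → x ≤ Real.pi →
      Real.log 2 / (2 * Real.pi) * (∫ y in (0 : ℝ)..Real.pi, (-fR c y) * Real.sin y) * Real.sin x ≤ gR c x

/-- **PROPOSITION 29.3 (a), typed (PROVED pen-and-paper; no equation used; the algebra is `sink_split_bound`,
`sink_lower_alg`, the inequalities `cot_half_le_two_div`, `tan_half_ge_half`): (29.5).** If `F ≤ N sin^β x` on
`(0,π)` (`0 < β ≤ 1`, `N > 0`), then the sink strain obeys `B₀ = −Hf(π) ≥ (A₀/8)(πβA₀/(4N))^{2/β}`, `A₀ = Hf(0)`: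
a negative odd function cannot flatten at the sink without its `C^{0,β}` quotient blowing up. -/
def SinkNondegStatement (NegP : ℝ → (ℤ → ℂ) → Prop) : Prop :=
  ∀ (a : ℝ) (c : ℤ → ℂ), NegP a c →
    ∀ β N : ℝ, 0 < β → β ≤ 1 → 0 < N →
      (∀ x : ℝ, 0 < x → x < Real.pi → -fR c x ≤ N * Real.sin x ^ β) →
        HfR c 0 / 8 * (Real.pi * β * HfR c 0 / (4 * N)) ^ (2 / β) ≤ -HfR c Real.pi

/-- The sink exponent along a family of profiles: `p(σ) = (1 − 1/Hf_σ(π))/a(σ)` ((2.2)). -/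
def branchP (aσ : ℝ → ℝ) (cσ : ℝ → ℤ → ℂ) (σ : ℝ) : ℝ := (1 - 1 / HfR (cσ σ) Real.pi) / aσ σ

/-- **The typed shadow of THEOREM M32's curve `γ = (ε, v) : (0,∞) → S`** as a family of coefficient sequences:
negative class-(H) profiles with `q₀ = 1` on the window `3/5 < a < 1`; Chen's parametrisation `a = 1 − σ` near
`σ = 0`; continuity of `a(σ)` and of the sink strain `Hf_σ(π)` on `(0,∞)` (hence of `p(σ)`, `continuousOn_p`); the
limits `a → 1`, `p → 1` at `0⁺`; local injectivity of the parametrisation ([BT03, Thm 9.1.1 (d),(f)] with Step 3);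
and alternative (29.9) in its Hölder form: on every compact sub-window `[a₁,a₂]`, for `σ > σ_R`, `(1−a)f_σ` violates
every prescribed `C^{0,β}` bound `R`.  NOT captured by the type (MECHANISM.md §29 only): the Banach-manifold structure
(distinguished arcs = analytic `X^{0,β}`-valued graphs over `ε`, discreteness of the singular set), the no-loop property
as such, and the identification of `f_σ` (`σ < ε₄`) with M28's `f_ε`. -/
structure BranchFamily (NegP : ℝ → (ℤ → ℂ) → Prop) (β : NNReal) (aσ : ℝ → ℝ) (cσ : ℝ → ℤ → ℂ) : Prop where
  profile : ∀ σ : ℝ, 0 < σ → NegP (aσ σ) (cσ σ)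
  source : ∀ σ : ℝ, 0 < σ → (1 - aσ σ) * HfR (cσ σ) 0 = 1
  window : ∀ σ : ℝ, 0 < σ → 3 / 5 < aσ σ ∧ aσ σ < 1
  sink : ∀ σ : ℝ, 0 < σ → HfR (cσ σ) Real.pi < 0
  chen : ∃ ε₄ : ℝ, 0 < ε₄ ∧ ∀ σ : ℝ, 0 < σ → σ < ε₄ → aσ σ = 1 - σ
  cont_a : ContinuousOn aσ (Set.Ioi 0)
  cont_sink : ContinuousOn (fun σ => HfR (cσ σ) Real.pi) (Set.Ioi 0)
  start_a : Tendsto aσ (𝓝[>] 0) (𝓝 1)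
  start_p : Tendsto (branchP aσ cσ) (𝓝[>] 0) (𝓝 1)
  locInj : ∀ σ : ℝ, 0 < σ → ∃ δ : ℝ, 0 < δ ∧ Set.InjOn (fun τ => (aσ τ, cσ τ)) (Set.Ioo (σ - δ) (σ + δ))
  escape : ∀ a₁ a₂ : ℝ, 3 / 5 < a₁ → a₁ ≤ a₂ → a₂ < 1 → ∀ R : NNReal, ∃ σR : ℝ, ∀ σ : ℝ, σR < σ →
    aσ σ ∈ Set.Icc a₁ a₂ → ¬ HolderWith R β (fun x => (1 - aσ σ) * fR (cσ σ) x)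

/-- **THEOREM 29.6 = THEOREM M32, typed shadow (PROVED pen-and-paper via LEMMAS 29.2, 29.4, 29.5 and [BT03, §9.1];
see `BranchFamily` for what the type does and does not capture):** for every Hölder exponent `β ∈ (0,1)` the De
Gregorio branch continues as a branch family. -/
def GlobalBranchStatement (NegP : ℝ → (ℤ → ℂ) → Prop) : Prop :=
  ∀ β : NNReal, 0 < β → β < 1 → ∃ (aσ : ℝ → ℝ) (cσ : ℝ → ℤ → ℂ), BranchFamily NegP β aσ cσ

/-- `p(σ)` is continuous on `(0,∞)` along a branch family (kernel-checked). -/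
theorem BranchFamily.continuousOn_p {NegP : ℝ → (ℤ → ℂ) → Prop} {β : NNReal} {aσ : ℝ → ℝ} {cσ : ℝ → ℤ → ℂ}
    (hF : BranchFamily NegP β aσ cσ) : ContinuousOn (branchP aσ cσ) (Set.Ioi 0) := by
  unfold branchP
  apply ContinuousOn.div
  · apply continuousOn_const.sub
    apply continuousOn_const.div hF.cont_sink
    intro σ hσ; exact ne_of_lt (hF.sink σ hσ)
  · exact hF.cont_a
  · intro σ hσ; have := (hF.window σ hσ).1; exact ne_of_gt (by linarith)

/-- **COROLLARY 29.7 (iii), kernel-checked:** along a branch family, `sup p = ∞` ⇒ every `P > 1` is a value of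
`p(σ)` (intermediate value theorem, `ladder_of_unbounded`, with `p → 1` at `0⁺`, `near_one_of_tendsto`). -/
theorem BranchFamily.ladder {NegP : ℝ → (ℤ → ℂ) → Prop} {β : NNReal} {aσ : ℝ → ℝ} {cσ : ℝ → ℤ → ℂ} (hF : BranchFamily NegP β aσ cσ)
    (hub : ∀ M : ℝ, ∃ σ : ℝ, 0 < σ ∧ M < branchP aσ cσ σ) :
    ∀ P : ℝ, 1 < P → ∃ σ : ℝ, 0 < σ ∧ branchP aσ cσ σ = P :=
  ladder_of_unbounded (branchP aσ cσ) hF.continuousOn_p (near_one_of_tendsto _ hF.start_p) hub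

/-- **COROLLARY 29.7 (iii) at the odd integers, kernel-checked:** `sup p = ∞` ⇒ for every `n` there is `σ > 0` at which
`f_σ` is a negative class-(H) profile with `q₀ = 1` and `Hf_σ(π) = −1/((2n+3)a − 1)` — the rung `P = 2n+3` is
realised ON THE BRANCH (and then `f_σ ∈ C^ω(𝕋)`, Corollary M9/17.3). -/
theorem BranchFamily.rung {NegP : ℝ → (ℤ → ℂ) → Prop} {β : NNReal} {aσ : ℝ → ℝ} {cσ : ℝ → ℤ → ℂ} (hF : BranchFamily NegP β aσ cσ)
    (hub : ∀ M : ℝ, ∃ σ : ℝ, 0 < σ ∧ M < branchP aσ cσ σ) (n : ℕ) :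
    ∃ σ : ℝ, 0 < σ ∧ NegP (aσ σ) (cσ σ) ∧ (1 - aσ σ) * HfR (cσ σ) 0 = 1 ∧
      HfR (cσ σ) Real.pi = -(1 / (aσ σ * (2 * (n : ℝ) + 3) - 1)) := by
  have hn : (0 : ℝ) ≤ (n : ℝ) := Nat.cast_nonneg n
  obtain ⟨σ, hσ, hp⟩ := hF.ladder hub (2 * (n : ℝ) + 3) (by linarith)
  refine ⟨σ, hσ, hF.profile σ hσ, hF.source σ hσ, ?_⟩
  have ha : aσ σ ≠ 0 := by have := (hF.window σ hσ).1; exact ne_of_gt (by linarith)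
  exact strain_of_rung (aσ σ) (HfR (cσ σ) Real.pi) (2 * (n : ℝ) + 3) (hF.sink σ hσ) ha hp

/-- **COROLLARY 29.7 (iv), kernel-checked along a family:** if `p ≤ p♯` on the branch then the sink strain stays
non-degenerate: `p♯a(σ) > 1` and `B₀(σ) = |Hf_σ(π)| ≥ 1/(p♯a(σ) − 1)` (`sink_strain_lower_of_p_le`). -/
theorem BranchFamily.sink_lower_of_bounded {NegP : ℝ → (ℤ → ℂ) → Prop} {β : NNReal} {aσ : ℝ → ℝ} {cσ : ℝ → ℤ → ℂ}
    (hF : BranchFamily NegP β aσ cσ) (psharp : ℝ) (hle : ∀ σ : ℝ, 0 < σ → branchP aσ cσ σ ≤ psharp) :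
    ∀ σ : ℝ, 0 < σ → 1 < psharp * aσ σ ∧ 1 / (psharp * aσ σ - 1) ≤ -HfR (cσ σ) Real.pi := by
  intro σ hσ
  have hB : 0 < -HfR (cσ σ) Real.pi := by linarith [hF.sink σ hσ]
  have ha0 : 0 < aσ σ := by linarith [(hF.window σ hσ).1]
  have hp : branchP aσ cσ σ = (1 + 1 / (-HfR (cσ σ) Real.pi)) / aσ σ := by
    unfold branchP; rw [one_div_neg_eq_neg_one_div]; ring
  exact sink_strain_lower_of_p_le (aσ σ) (-HfR (cσ σ) Real.pi) _ psharp ha0 hB hp (hle σ hσ)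

/-- **THE LADDER ON THE BRANCH, typed (COROLLARY 29.7 (iii), CONDITIONAL on `sup p = ∞`):** a branch family on which,
IF the sink exponent is unbounded, every odd rung `P = 2n + 3 ≥ 3` is realised. -/
def LadderOnBranchStatement (NegP : ℝ → (ℤ → ℂ) → Prop) : Prop :=
  ∀ β : NNReal, 0 < β → β < 1 → ∃ (aσ : ℝ → ℝ) (cσ : ℝ → ℤ → ℂ), BranchFamily NegP β aσ cσ ∧
    ((∀ M : ℝ, ∃ σ : ℝ, 0 < σ ∧ M < branchP aσ cσ σ) →
      ∀ n : ℕ, ∃ σ : ℝ, 0 < σ ∧ NegP (aσ σ) (cσ σ) ∧ (1 - aσ σ) * HfR (cσ σ) 0 = 1 ∧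
        HfR (cσ σ) Real.pi = -(1 / (aσ σ * (2 * (n : ℝ) + 3) - 1)))

/-- The reduction GlobalBranch ⇒ LadderOnBranch (kernel-checked). -/
theorem ladderOnBranch_of {NegP : ℝ → (ℤ → ℂ) → Prop} (hG : GlobalBranchStatement NegP) :
    LadderOnBranchStatement NegP := by
  intro β hβ0 hβ1
  obtain ⟨aσ, cσ, hF⟩ := hG β hβ0 hβ1
  exact ⟨aσ, cσ, hF, fun hub n => hF.rung hub n⟩

/-- **QUESTION 29.8 (a), typed — OPEN:** regularity of the negative simple-source class AT BOUNDED SINK EXPONENT: on a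
compact sub-window `[a₁,a₂] ⊂ (3/5,1)` and with `|Hf(π)| ≥ b > 0`, the `C^{0,β}` seminorm of `(1−a)f` is bounded by
some `R(a₁,a₂,b)`.  NOT used as a hypothesis anywhere except by name (`sink_degenerates_of_conjecture`). -/
def HolderAprioriConjecture (NegP : ℝ → (ℤ → ℂ) → Prop) : Prop :=
  ∀ β : NNReal, 0 < β → β < 1 → ∀ a₁ a₂ b : ℝ, 3 / 5 < a₁ → a₁ ≤ a₂ → a₂ < 1 → 0 < b →
    ∃ R : NNReal, ∀ (a : ℝ) (c : ℤ → ℂ), NegP a c → (1 - a) * HfR c 0 = 1 →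
      a ∈ Set.Icc a₁ a₂ → b ≤ -HfR c Real.pi → HolderWith R β (fun x => (1 - a) * fR c x)

/-- Under `HolderAprioriConjecture`, alternative (E1) forces the sink to degenerate (`p → ∞`) on every compact
sub-window: along a branch family, for `σ > σ_R` with `a(σ) ∈ [a₁,a₂]`, `|Hf_σ(π)| < b` (kernel-checked bookkeeping). -/
theorem BranchFamily.sink_degenerates_of_conjecture {NegP : ℝ → (ℤ → ℂ) → Prop} {β : NNReal} {aσ : ℝ → ℝ} {cσ : ℝ → ℤ → ℂ}
    (hF : BranchFamily NegP β aσ cσ) (hβ0 : 0 < β) (hβ1 : β < 1) (hQ : HolderAprioriConjecture NegP)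
    (a₁ a₂ b : ℝ) (h1 : 3 / 5 < a₁) (h12 : a₁ ≤ a₂) (h2 : a₂ < 1) (hb : 0 < b) :
    ∃ σR : ℝ, ∀ σ : ℝ, σR < σ → 0 < σ → aσ σ ∈ Set.Icc a₁ a₂ → -HfR (cσ σ) Real.pi < b := by
  obtain ⟨R, hR⟩ := hQ β hβ0 hβ1 a₁ a₂ b h1 h12 h2 hb
  obtain ⟨σR, hσR⟩ := hF.escape a₁ a₂ h1 h12 h2 R
  refine ⟨σR, fun σ hσ hσ0 ha => ?_⟩
  by_contra hcon
  exact hσR σ hσ ha (hR (aσ σ) (cσ σ) (hF.profile σ hσ0) (hF.source σ hσ0) ha (not_lt.mp hcon))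

/-- **The v23 bundle of this module:** Lemma 29.1(b) ∧ Prop. 29.3(a) ∧ THEOREM M32 (typed shadow), parametric in the
profile hypothesis `NegP`; the intended instantiation `MechanismStatementV23 := MechanismStatementV22 ∧ GlobalBranchBundle
NegProfileHyp` is ONE line, to be added when both files live in one import graph (see the module docstring). -/
def GlobalBranchBundle (NegP : ℝ → (ℤ → ℂ) → Prop) : Prop :=
  KernelLowerStatement NegP ∧ SinkNondegStatement NegP ∧ GlobalBranchStatement NegP

/-- The v23 bundle `GlobalBranchBundle NegP` implies `LadderOnBranchStatement NegP`. -/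
theorem ladderOnBranch_of_v23 {NegP : ℝ → (ℤ → ℂ) → Prop} (h : GlobalBranchBundle NegP) :
    LadderOnBranchStatement NegP :=
  ladderOnBranch_of h.2.2

end Summit.NavierStokesRegularity.OSWSelfSimilar.Mechanism.GlobalBranch


/-! ## §30 (v24): the chord slope — LEMMA 30.1, THEOREM 30.3, LEMMA 30.4, THEOREM M33, COROLLARY 30.6, THEOREM 30.7,
REMARK 30.8 (MECHANISM.md v24 §30).  1-D model (gCLM/OSW), computer-assisted; not Euler/NS. -/

namespace Summit.NavierStokesRegularity.OSWSelfSimilar.Mechanism.ChordSlope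

open Summit.NavierStokesRegularity.OSWSelfSimilar.Mechanism.GlobalBranch

/-! ### LEMMA 30.1 (a): trigonometric and algebraic core -/

/-- `sin y · cot(y/2) = 1 + cos y` (the chord integrand against the source kernel `cot(y/2)` of (20.0)). -/
theorem sin_mul_cot_half (y : ℝ) (h : Real.sin (y / 2) ≠ 0) :
    Real.sin y * Real.cot (y / 2) = 1 + Real.cos y := by
  have hs : Real.sin y = 2 * Real.sin (y / 2) * Real.cos (y / 2) := by
    have := Real.sin_two_mul (y / 2); rw [show 2 * (y / 2) = y by ring] at this; exact this
  have hc : Real.cos y = 2 * Real.cos (y / 2) ^ 2 - 1 := by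
    have := Real.cos_two_mul (y / 2); rw [show 2 * (y / 2) = y by ring] at this; exact this
  rw [Real.cot_eq_cos_div_sin, hs, hc]
  field_simp
  ring

/-- `sin y · tan(y/2) = 1 − cos y` (the chord integrand against the sink kernel `tan(y/2)` of (20.0)). -/
theorem sin_mul_tan_half (y : ℝ) (h : Real.cos (y / 2) ≠ 0) :
    Real.sin y * Real.tan (y / 2) = 1 - Real.cos y := by
  have hs : Real.sin y = 2 * Real.sin (y / 2) * Real.cos (y / 2) := by
    have := Real.sin_two_mul (y / 2); rw [show 2 * (y / 2) = y by ring] at this; exact this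
  have hc : Real.cos y = 2 * Real.cos (y / 2) ^ 2 - 1 := by
    have := Real.cos_two_mul (y / 2); rw [show 2 * (y / 2) = y by ring] at this; exact this
  have ht : Real.sin y * Real.tan (y / 2) = 2 * Real.sin (y / 2) ^ 2 := by
    rw [Real.tan_eq_sin_div_cos, hs]; field_simp
  rw [ht, hc]
  linarith [Real.sin_sq_add_cos_sq (y / 2)]

/-- `∫₀^π (1 + cos y) dy = π`: with `sin y cot(y/2) = 1 + cos y`, the chord `N₁ sin` has source strain exactly `N₁`
(`πA₀ ≤ N₁ ∫₀^π (1 + cos) = πN₁`, LEMMA 30.1 (a)). -/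
theorem integral_one_add_cos : ∫ y in (0:ℝ)..Real.pi, (1 + Real.cos y) = Real.pi := by
  have hW : ∀ x : ℝ, HasDerivAt (fun x => x + Real.sin x) (1 + Real.cos x) x := by
    intro x
    exact (hasDerivAt_id' x).add (Real.hasDerivAt_sin x)
  rw [intervalIntegral.integral_eq_sub_of_hasDerivAt (fun x _ => hW x)
      ((continuous_const.add Real.continuous_cos).intervalIntegrable _ _)]
  simp

/-- LEMMA 30.1 (a), (30.2): from the split `πA₀ ≤ 2N₁δ + 2‖F‖₂δ^{-1/2}` at `δ = πA₀/(4N₁)` (so `2N₁δ = πA₀/2`):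
`‖F‖₂² ≥ π³A₀³/(64 N₁)`. -/
theorem l2_lower_alg (A0 N L δ : ℝ) (hA : 0 < A0) (hN : 0 < N)
    (hδ : δ = Real.pi * A0 / (4 * N))
    (h : Real.pi * A0 / 2 ≤ 2 * L / Real.sqrt δ) :
    Real.pi ^ 3 * A0 ^ 3 / (64 * N) ≤ L ^ 2 := by
  have hδpos : 0 < δ := by rw [hδ]; positivity
  have hs : 0 < Real.sqrt δ := Real.sqrt_pos.mpr hδpos
  have h1 : Real.pi * A0 * Real.sqrt δ ≤ 4 * L := by
    have := (le_div_iff₀ hs).mp h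
    linarith
  have h2 : (Real.pi * A0 * Real.sqrt δ) ^ 2 ≤ (4 * L) ^ 2 :=
    pow_le_pow_left₀ (by positivity) h1 2
  have h3 : (Real.pi * A0 * Real.sqrt δ) ^ 2 = Real.pi ^ 2 * A0 ^ 2 * δ := by
    rw [mul_pow, Real.sq_sqrt hδpos.le]; ring
  rw [h3, hδ] at h2
  have h4 : Real.pi ^ 3 * A0 ^ 3 / (64 * N) = Real.pi ^ 2 * A0 ^ 2 * (Real.pi * A0 / (4 * N)) / 16 := by
    field_simp; ring
  rw [h4]; linarith

/-- LEMMA 30.1 (a): `m₁ ≥ ‖F‖₂²/N₁ ≥ π³A₀³/(64N₁²)` and `min G ≥ (log 2/(2π)) m₁` give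
`min G ≥ c_G = (π² log 2/128) A₀³/N₁²`. -/
theorem cG_alg (A0 N L2 m1 : ℝ) (hN : 0 < N)
    (h1 : Real.pi ^ 3 * A0 ^ 3 / (64 * N) ≤ L2) (h2 : L2 / N ≤ m1) :
    Real.pi ^ 2 * Real.log 2 / 128 * (A0 ^ 3 / N ^ 2) ≤ Real.log 2 / (2 * Real.pi) * m1 := by
  have hlog : 0 < Real.log 2 := Real.log_pos (by norm_num)
  have h3 : Real.pi ^ 3 * A0 ^ 3 / (64 * N) / N ≤ m1 :=
    le_trans (div_le_div_of_nonneg_right h1 hN.le) h2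
  have h4 : Real.pi ^ 2 * Real.log 2 / 128 * (A0 ^ 3 / N ^ 2)
      = Real.log 2 / (2 * Real.pi) * (Real.pi ^ 3 * A0 ^ 3 / (64 * N) / N) := by
    field_simp; ring
  rw [h4]
  exact mul_le_mul_of_nonneg_left h3 (by positivity)

/-- THEOREM M33, first clause: `𝔰 = (1−a)N₁ ≥ (1−a)A₀ = 1`, strictly if `A₀ < N₁`. -/
theorem chordSlope_ge_one (a A0 N : ℝ) (ha : a < 1) (hsrc : (1 - a) * A0 = 1) (hle : A0 ≤ N) :
    1 ≤ (1 - a) * N := by nlinarith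

/-- Chord slope: if `a < 1`, `(1−a)A₀ = 1` and `A₀ < N` then `1 < (1−a)N`. -/
theorem chordSlope_gt_one (a A0 N : ℝ) (ha : a < 1) (hsrc : (1 - a) * A0 = 1) (hlt : A0 < N) :
    1 < (1 - a) * N := by nlinarith

/-! ### LEMMA 30.1 (b), (c): one use of the equation; the sup bound from a zero -/

/-- LEMMA 30.1 (b): from (T1) `a g f′ = f(h−1)` with `f = −u sin x`, `g = G sin x`, `sin x > 0`:
`f′ = −u(h−1)/(aG)` and `|f′| ≤ N₁(|h|+1)/(a c_G)` when `0 ≤ u ≤ N₁`, `G ≥ c_G > 0`. -/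
theorem fprime_pointwise_alg (a u s G h fp N c : ℝ) (ha : 0 < a) (hs : 0 < s) (hG : c ≤ G) (hc : 0 < c)
    (hu0 : 0 ≤ u) (huN : u ≤ N)
    (heq : a * (G * s) * fp = (-(u * s)) * (h - 1)) :
    fp = -(u * (h - 1)) / (a * G) ∧ |fp| ≤ N * (|h| + 1) / (a * c) := by
  have hGpos : 0 < G := lt_of_lt_of_le hc hG
  have h1 : fp = -(u * (h - 1)) / (a * G) := by
    rw [eq_div_iff (by positivity)]
    have h2 : (fp * (a * G)) * s = (-(u * (h - 1))) * s := by linear_combination heq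
    exact mul_right_cancel₀ (ne_of_gt hs) h2
  refine ⟨h1, ?_⟩
  have hN : 0 ≤ N := le_trans hu0 huN
  rw [h1, abs_div, abs_neg, abs_mul, abs_of_nonneg hu0, abs_of_pos (by positivity : 0 < a * G)]
  rw [div_le_div_iff₀ (by positivity) (by positivity)]
  have hh : |h - 1| ≤ |h| + 1 := by
    calc |h - 1| ≤ |h| + |(1:ℝ)| := abs_sub h 1
      _ = |h| + 1 := by simp
  have h3 : u * |h - 1| ≤ N * (|h| + 1) := mul_le_mul huN hh (abs_nonneg _) hN
  have h4 : a * c ≤ a * G := by nlinarith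
  calc u * |h - 1| * (a * c) ≤ N * (|h| + 1) * (a * c) := mul_le_mul_of_nonneg_right h3 (by positivity)
    _ ≤ N * (|h| + 1) * (a * G) := mul_le_mul_of_nonneg_left h4 (mul_nonneg hN (by positivity))

/-- LEMMA 30.1 (c): a mean-zero `h` vanishes somewhere; with `|h x − h y| ≤ C·D(x,y)^{1/2}` and arc distances
`D ≤ π`: `sup |h| ≤ π^{1/2} C`. -/
theorem sup_le_of_vanish_holder (h : ℝ → ℝ) (D : ℝ → ℝ → ℝ) (C : ℝ) (hC : 0 ≤ C)
    (hD : ∀ x y, D x y ≤ Real.pi)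
    (hH : ∀ x y, |h x - h y| ≤ C * Real.sqrt (D x y)) (xz : ℝ) (hz : h xz = 0) :
    ∀ x, |h x| ≤ Real.sqrt Real.pi * C := by
  intro x
  have h1 := hH x xz
  rw [hz, sub_zero] at h1
  calc |h x| ≤ C * Real.sqrt (D x xz) := h1
    _ ≤ C * Real.sqrt Real.pi := mul_le_mul_of_nonneg_left (Real.sqrt_le_sqrt (hD x xz)) hC
    _ = Real.sqrt Real.pi * C := by ring

/-- LEMMA 30.1 (e): `x ≤ (π/2) sin x` on `[0, π/2]` (Jordan), so `F(x) ≤ ‖f′‖_∞ x ≤ ‖f′‖_∞ (π/2) sin x`. -/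
theorem le_pi_div_two_mul_sin (x : ℝ) (h0 : 0 ≤ x) (h1 : x ≤ Real.pi / 2) :
    x ≤ Real.pi / 2 * Real.sin x := by
  have := Real.mul_le_sin h0 h1
  -- Real.mul_le_sin : 0 ≤ x → x ≤ π/2 → 2/π * x ≤ sin x
  have hπ := Real.pi_pos
  rw [div_mul_eq_mul_div, le_div_iff₀ (by norm_num : (0:ℝ) < 2)]
  have := mul_le_mul_of_nonneg_left this hπ.le
  calc x * 2 = Real.pi * (2 / Real.pi * x) := by field_simp
    _ ≤ Real.pi * Real.sin x := this

/-! ### LEMMA 30.4: the sink strain from mass and chord -/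

/-- LEMMA 30.4 (a): `πB₀ ≤ 2M/η + 2N₁η` at `η² N₁ = M` gives `B₀ ≤ (4/π)(M N₁)^{1/2}`. -/
theorem sink_upper_opt (B0 M N η : ℝ) (hN : 0 < N) (hη : 0 < η) (hM : η ^ 2 * N = M)
    (h : Real.pi * B0 ≤ 2 * M / η + 2 * N * η) : B0 ≤ 4 / Real.pi * Real.sqrt (M * N) := by
  have hπ := Real.pi_pos
  have h1 : 2 * M / η + 2 * N * η = 4 * N * η := by
    rw [← hM]; field_simp; ring
  have h2 : Real.sqrt (M * N) = η * N := by
    rw [← hM, show η ^ 2 * N * N = (η * N) ^ 2 by ring, Real.sqrt_sq (by positivity)]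
  rw [h2]
  rw [h1] at h
  have h3 : B0 ≤ 4 * N * η / Real.pi := by rw [le_div_iff₀ hπ]; linarith
  calc B0 ≤ 4 * N * η / Real.pi := h3
    _ = 4 / Real.pi * (η * N) := by field_simp

/-- LEMMA 30.4 (b): the weight `w(x) = (π/2) sin x − (1 − cos x) = sin x · (π/2 − tan(x/2))`. -/
theorem weight_factor (x : ℝ) (h : Real.cos (x / 2) ≠ 0) :
    Real.pi / 2 * Real.sin x - (1 - Real.cos x) = Real.sin x * (Real.pi / 2 - Real.tan (x / 2)) := by
  have hc : Real.cos x = 2 * Real.cos (x / 2) ^ 2 - 1 := by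
    have := Real.cos_two_mul (x / 2); rw [show 2 * (x / 2) = x by ring] at this; exact this
  have ht : Real.sin x * Real.tan (x / 2) = 1 - Real.cos x := sin_mul_tan_half x h
  rw [mul_sub, ht]
  ring

end Summit.NavierStokesRegularity.OSWSelfSimilar.Mechanism.ChordSlope
end
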